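import Summits.ResolutionOfSingularities.ResolutionOfSingularities.Theorems.FrobeniusClosingSteerDerivationTaylor
import Summits.ResolutionOfSingularities.ResolutionOfSingularities.Theorems.FrobeniusClosingSteerWords03Phases
import Summits.ResolutionOfSingularities.ResolutionOfSingularities.Theorems.FrobeniusClosingSteerHullVocabulary
import Summits.ResolutionOfSingularities.ResolutionOfSingularities.Theorems.FrobeniusClosingSteerCore4LowMultTwoCore
import Literature.AlgebraicGeometry.Resolution.RegularLocalRingsQuotient
import Literature.AlgebraicGeometry.Resolution.RegularLocalRingsJacobian
import Literature.AlgebraicGeometry.Resolution.QuadraticTransforms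
import HarnessLib

/-!
# Crux `Steer` (stmt-ResolutionOfSingularities-16345), line `switching_dichotomy`, card `singular-trace-constructor`:
# the DERIVATION CRITERION, Stage C — the constants `R = S ∩ ker D` of a derivation with `D(S) ⊆ S`, `D y = 1`, `D^p = 0`
# on a regular local `S` form a REGULAR LOCAL RING with `y ^ p ∈ 𝔪_R ∖ 𝔪_R²`; hence `ExitAt R p t` for every `t ∈ S`

OURS (campaign `res-hironaka`, rung L ★L-G4, slot W4.1, chain W4.1; seat `res-type-083` g8 on res-L0-w41-strat-1 g6's CONSULT
2026-08-27T11:48:57Z (3) «DERIVATION CRITERION `exitAt_of_derivation_unit`» (KN-free direction of the card; source of the argument: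
Miyanishi–Ito, *Algebraic Surfaces in Positive Characteristics*, Ch. 1, Lemma on reduced p-closed derivations, assertion (4), elementary
Taylor direction — strat-1's sketch); Theses-free, definition-free helper `--supports stmt-ResolutionOfSingularities-16345`; replaces the role
of no printed item; NOT a statement of the manuscript under review [claim: Hironaka2017, status: under-review]; AI-produced, weaker than
expert review).

Setting as in Stage A (`…FrobeniusClosingSteerDerivationTaylor`, p530745): `K` of characteristic `p`, `S ≤ K` a subring containing the
image of `k`, `D : Derivation k K K` with `D(S) ⊆ S`, `y ∈ S` with `D y = 1`, `D^p = 0` on `S` (hypothesis `hDp`), constants `R` by the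
membership clause `hR : ∀ x, x ∈ R ↔ x ∈ S ∧ D x = 0`.
* `isLocalRing_constants` — `S` local ⇒ `R` local (a constant invertible in `S` inverts in `R`);
* `apply_taylorProj_eq_zero` + `taylorProj_*` — strat-1's Taylor projector `π s := Σ_{j<p} (−1)^j (j!⁻¹ y^j) D^j s` lands in `R`, is
  additive, `R`-linear and the identity on `R`; `mem_of_inclusion_mem_map` — PURITY `I·S ∩ R = I` for every ideal `I ≤ R`;
  `isNoetherianRing_constants` — `S` Noetherian ⇒ `R` Noetherian (chains of `R`-ideals extend to `S` and are pulled back by purity);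
* `quotientEquiv` facts — `R ⧸ (y^p) ≃+* S ⧸ (y)` (surjective by the Taylor expansion, kernel `R ∩ y·S = y^p·R`);
* `not_mem_sq_of_apply_eq_one` — `y ∉ 𝔪_S²` (`D(𝔪_S²) ⊆ 𝔪_S` but `D y = 1`);
* `isRegularLocalRing_constants`, `pow_char_not_mem_sq` — **`R` is regular local and `y ^ p ∈ 𝔪_R ∖ 𝔪_R²`** (tree: `S/(y)` regular by
  `IsRegularLocalRing.quotient_span_singleton`, transport along the iso, `IsRegularLocalRing.of_quotient_span_singleton`, and
  `not_isRegularLocalRing_quotient_span_singleton_of_mem_sq`);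
* **`exitAt_of_derivation_unit`** — `GenAt R p t y ∧ OrderOneGen R p y` (cleaner `g := 0`, `isRsopPart_one_of_not_mem_sq`), i.e.
  `ExitAt R p t`, for every `t ∈ S`. [folklore]
-/

-- `Summit.<S>.<S>.…` duplicates the summit name by design (single-problem summit).
set_option linter.dupNamespace false

open scoped Nat
open IsLocalRing
open Literature.AlgebraicGeometry.Resolution
open Summit.ResolutionOfSingularities.ResolutionOfSingularities.Theorems.SwitchingDichotomy.Words

namespace Summit.ResolutionOfSingularities.ResolutionOfSingularities.Theorems.SwitchingDichotomy

namespace DerivationExit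

variable {k K : Type} [Field k] [Field K] [Algebra k K]

section Constants

variable (p : ℕ) [Fact p.Prime] [CharP K p] (S : Subring K) (D : Derivation k K K)
  (hDS : ∀ s ∈ S, D s ∈ S) (hkS : ∀ c : k, algebraMap k K c ∈ S) {y : K} (hyS : y ∈ S) (hy : D y = 1)
  (hDp : ∀ s ∈ S, ((D : K →ₗ[k] K) ^ p) s = 0)
  (R : Subring K) (hR : ∀ x, x ∈ R ↔ x ∈ S ∧ D x = 0)

/-! ## `R ≤ S`, units, locality -/

omit [Fact p.Prime] [CharP K p] in
include hR in
/-- `R ≤ S`. [folklore] -/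
theorem constants_le : R ≤ S := fun x hx => ((hR x).mp hx).1

omit [Fact p.Prime] [CharP K p] in
include hR in
/-- A constant is a unit of `R` iff it is a unit of `S` (its inverse in `S` is again a constant). [folklore] -/
theorem isUnit_constants_iff (r : R) : IsUnit r ↔ IsUnit (Subring.inclusion (constants_le S D R hR) r) := by
  rw [isUnit_subring_iff_inv_mem, isUnit_subring_iff_inv_mem]
  change (r : K) ≠ 0 ∧ (r : K)⁻¹ ∈ R ↔ (r : K) ≠ 0 ∧ (r : K)⁻¹ ∈ S
  refine ⟨fun ⟨h0, hinv⟩ => ⟨h0, ((hR _).mp hinv).1⟩, fun ⟨h0, hinv⟩ => ⟨h0, (hR _).mpr ⟨hinv, ?_⟩⟩⟩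
  exact apply_inv_eq_zero D ((hR r).mp r.2).2

omit [Fact p.Prime] [CharP K p] in
include hR in
/-- **`R` is local when `S` is.** [folklore] -/
theorem isLocalRing_constants [IsLocalRing S] : IsLocalRing R := by
  refine IsLocalRing.of_nonunits_add ?_
  intro a b ha hb
  rw [mem_nonunits_iff, isUnit_constants_iff S D R hR] at ha hb ⊢
  rw [map_add]
  exact IsLocalRing.nonunits_add ha hb

/-! ## The Taylor projector `π s := Σ_{j<p} (−1)^j (j!⁻¹ y^j) D^j s` -/

omit [Fact p.Prime] in
include hy hDp in
/-- **`D (π s) = 0`** for `s ∈ S` (telescoping; the last term carries `D^p s = 0`). [folklore] -/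
theorem apply_taylorProj_eq_zero (hp1 : 1 ≤ p) {s : K} (hs : s ∈ S) :
    D (∑ j ∈ Finset.range p, (-1 : K) ^ j * (((((j ! : ℕ) : K))⁻¹ * y ^ j) * ((D : K →ₗ[k] K) ^ j) s)) = 0 := by
  obtain ⟨q, hq⟩ : ∃ q, p = q + 1 := ⟨p - 1, (Nat.sub_add_cancel hp1).symm⟩
  -- `D` of each term
  have hterm : ∀ j, D ((-1 : K) ^ j * (((((j ! : ℕ) : K))⁻¹ * y ^ j) * ((D : K →ₗ[k] K) ^ j) s)) =
      (-1 : K) ^ j * (D ((((j ! : ℕ) : K))⁻¹ * y ^ j) * ((D : K →ₗ[k] K) ^ j) s +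
        ((((j ! : ℕ) : K))⁻¹ * y ^ j) * ((D : K →ₗ[k] K) ^ (j + 1)) s) := by
    intro j
    have hneg : D ((-1 : K) ^ j) = 0 := by
      rw [Derivation.leibniz_pow, Derivation.map_neg, Derivation.map_one_eq_zero, neg_zero, smul_zero, smul_zero]
    rw [apply_mul_of_apply_eq_zero D hneg, Derivation.leibniz, smul_eq_mul, smul_eq_mul, pow_succ', Module.End.mul_apply,
      Derivation.coeFn_coe]
    ring
  rw [map_sum, Finset.sum_congr rfl fun j _ => hterm j]
  simp_rw [mul_add, Finset.sum_add_distrib]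
  -- first sum: peel `j = 0` (`D 1 = 0`), shift; second sum: peel `j = q` (`D^p s = 0`)
  rw [hq, Finset.sum_range_succ' (fun j => (-1 : K) ^ j * (D ((((j ! : ℕ) : K))⁻¹ * y ^ j) * ((D : K →ₗ[k] K) ^ j) s)),
    Finset.sum_range_succ (fun j => (-1 : K) ^ j * ((((j ! : ℕ) : K))⁻¹ * y ^ j * ((D : K →ₗ[k] K) ^ (j + 1)) s))]
  have h0 : (-1 : K) ^ 0 * (D ((((0 ! : ℕ) : K))⁻¹ * y ^ 0) * ((D : K →ₗ[k] K) ^ 0) s) = 0 := by simp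
  have hp0 : ((D : K →ₗ[k] K) ^ (q + 1)) s = 0 := by rw [← hq]; exact hDp s hs
  rw [h0, hp0, add_zero, mul_zero, mul_zero, add_zero, ← Finset.sum_add_distrib]
  refine Finset.sum_eq_zero fun i hi => ?_
  have hi' : i + 1 < p := by rw [hq]; exact Nat.succ_lt_succ (Finset.mem_range.mp hi)
  rw [apply_dividedPower_succ p D hy hi']
  ring

omit [Fact p.Prime] [CharP K p] in
include hDS hkS hyS in
/-- `π s ∈ S` for `s ∈ S`. [folklore] -/
theorem taylorProj_mem {s : K} (hs : s ∈ S) :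
    (∑ j ∈ Finset.range p, (-1 : K) ^ j * (((((j ! : ℕ) : K))⁻¹ * y ^ j) * ((D : K →ₗ[k] K) ^ j) s)) ∈ S :=
  Subring.sum_mem _ fun j _ => S.mul_mem (S.pow_mem (S.neg_mem S.one_mem) j)
    (S.mul_mem (dividedPower_mem S hkS hyS j) (pow_apply_mem S D hDS j hs))

include hDS hkS hyS hy hDp hR in
/-- `π s ∈ R` for `s ∈ S`. [folklore] -/
theorem taylorProj_mem_constants {s : K} (hs : s ∈ S) :
    (∑ j ∈ Finset.range p, (-1 : K) ^ j * (((((j ! : ℕ) : K))⁻¹ * y ^ j) * ((D : K →ₗ[k] K) ^ j) s)) ∈ R :=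
  (hR _).mpr ⟨taylorProj_mem p S D hDS hkS hyS hs,
    apply_taylorProj_eq_zero p S D hy hDp (Fact.out : p.Prime).one_le hs⟩

omit [Fact p.Prime] [CharP K p] in
/-- `π` is right-linear over the constants: `π (s * a) = π s * a` for `D a = 0`. [folklore] -/
theorem taylorProj_mul_constant (s : K) {a : K} (ha : D a = 0) :
    (∑ j ∈ Finset.range p, (-1 : K) ^ j * (((((j ! : ℕ) : K))⁻¹ * y ^ j) * ((D : K →ₗ[k] K) ^ j) (s * a))) =
      (∑ j ∈ Finset.range p, (-1 : K) ^ j * (((((j ! : ℕ) : K))⁻¹ * y ^ j) * ((D : K →ₗ[k] K) ^ j) s)) * a := by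
  rw [Finset.sum_mul]
  refine Finset.sum_congr rfl fun j _ => ?_
  rw [mul_comm s a, pow_apply_mul_of_apply_eq_zero D ha]
  ring

omit [Fact p.Prime] [CharP K p] in
/-- `π` is additive. [folklore] -/
theorem taylorProj_add (s s' : K) :
    (∑ j ∈ Finset.range p, (-1 : K) ^ j * (((((j ! : ℕ) : K))⁻¹ * y ^ j) * ((D : K →ₗ[k] K) ^ j) (s + s'))) =
      (∑ j ∈ Finset.range p, (-1 : K) ^ j * (((((j ! : ℕ) : K))⁻¹ * y ^ j) * ((D : K →ₗ[k] K) ^ j) s)) +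
      (∑ j ∈ Finset.range p, (-1 : K) ^ j * (((((j ! : ℕ) : K))⁻¹ * y ^ j) * ((D : K →ₗ[k] K) ^ j) s')) := by
  rw [← Finset.sum_add_distrib]
  refine Finset.sum_congr rfl fun j _ => ?_
  rw [map_add]
  ring

omit [Fact p.Prime] [CharP K p] in
/-- `π a = a` for a constant `a` (all `D^j a`, `j ≥ 1`, vanish). [folklore] -/
theorem taylorProj_constant (hp1 : 1 ≤ p) {a : K} (ha : D a = 0) :
    (∑ j ∈ Finset.range p, (-1 : K) ^ j * (((((j ! : ℕ) : K))⁻¹ * y ^ j) * ((D : K →ₗ[k] K) ^ j) a)) = a := by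
  rw [Finset.sum_eq_single_of_mem 0 (Finset.mem_range.mpr hp1)]
  · simp
  · intro j _ hj
    obtain ⟨i, rfl⟩ := Nat.exists_eq_succ_of_ne_zero hj
    have : ((D : K →ₗ[k] K) ^ (i + 1)) a = 0 := by
      rw [pow_succ, Module.End.mul_apply, Derivation.coeFn_coe, ha, map_zero]
    rw [this, mul_zero, mul_zero]

/-! ## Purity and the Noetherian property -/

include hDS hkS hyS hy hDp hR in
/-- **PURITY `I·S ∩ R = I`**: if the image of `r ∈ R` in `S` lies in the extension of an ideal `I ≤ R`, then `r ∈ I` (apply the Taylor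
projector). [folklore] -/
theorem mem_of_inclusion_mem_map (I : Ideal R) (r : R)
    (hr : Subring.inclusion (constants_le S D R hR) r ∈ I.map (Subring.inclusion (constants_le S D R hR))) : r ∈ I := by
  have hp1 : 1 ≤ p := (Fact.out : p.Prime).one_le
  -- the property «`π (s' · x) ∈ I` for every `s' ∈ S`» is stable along the span `I·S`
  have key : ∀ x ∈ I.map (Subring.inclusion (constants_le S D R hR)), ∀ s' : S, ∃ a ∈ I,
      (a : K) = (∑ j ∈ Finset.range p, (-1 : K) ^ j * (((((j ! : ℕ) : K))⁻¹ * y ^ j) * ((D : K →ₗ[k] K) ^ j) ((s' : K) * (x : K)))) := by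
    intro x hx
    have hx' : x ∈ Submodule.span S (Subring.inclusion (constants_le S D R hR) '' (I : Set R)) := hx
    refine Submodule.span_induction (p := fun (x : S) (_ : x ∈ Submodule.span S
        (Subring.inclusion (constants_le S D R hR) '' (I : Set R))) => ∀ s' : S, ∃ a ∈ I,
          (a : K) = (∑ j ∈ Finset.range p, (-1 : K) ^ j * (((((j ! : ℕ) : K))⁻¹ * y ^ j) * ((D : K →ₗ[k] K) ^ j) ((s' : K) * (x : K))))) ?_ ?_ ?_ ?_ hx'
    · rintro _ ⟨a, ha, rfl⟩ s'
      refine ⟨⟨(∑ j ∈ Finset.range p, (-1 : K) ^ j * (((((j ! : ℕ) : K))⁻¹ * y ^ j) * ((D : K →ₗ[k] K) ^ j) ((s' : K)))), taylorProj_mem_constants p S D hDS hkS hyS hy hDp R hR s'.2⟩ * a,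
        I.mul_mem_left _ ha, ?_⟩
      rw [Subring.coe_mul]
      exact (taylorProj_mul_constant p D (s' : K) ((hR _).mp a.2).2).symm
    · intro s'
      refine ⟨0, I.zero_mem, ?_⟩
      rw [ZeroMemClass.coe_zero, ZeroMemClass.coe_zero, mul_zero]
      exact (taylorProj_constant p D hp1 (map_zero D)).symm
    · intro x z _ _ hx hz s'
      obtain ⟨a, ha, hax⟩ := hx s'
      obtain ⟨b, hb, hbz⟩ := hz s'
      refine ⟨a + b, I.add_mem ha hb, ?_⟩
      rw [AddMemClass.coe_add, AddMemClass.coe_add, mul_add, taylorProj_add p D, hax, hbz]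
    · intro c x _ hx s'
      obtain ⟨a, ha, hax⟩ := hx (s' * c)
      refine ⟨a, ha, ?_⟩
      rw [hax, Subring.coe_mul, smul_eq_mul, Subring.coe_mul, mul_assoc]
  obtain ⟨a, ha, har⟩ := key _ hr 1
  have h1 : ((1 : S) : K) * ((Subring.inclusion (constants_le S D R hR) r : S) : K) = (r : K) := by
    rw [OneMemClass.coe_one, one_mul]; rfl
  rw [h1, taylorProj_constant p D hp1 ((hR _).mp r.2).2] at har
  have : a = r := Subtype.ext har
  exact this ▸ ha

include hDS hkS hyS hy hDp hR in
/-- **`R` is Noetherian when `S` is**: an increasing chain of ideals of `R` extends to `S`, stabilises there, and is recovered by purity.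
[folklore] -/
theorem isNoetherianRing_constants [IsNoetherianRing S] : IsNoetherianRing R := by
  rw [isNoetherianRing_iff, ← monotone_stabilizes_iff_noetherian]
  intro f
  let ι := Subring.inclusion (constants_le S D R hR)
  let g : ℕ →o Ideal S := ⟨fun n => Ideal.map ι (f n), fun a b hab => Ideal.map_mono (f.monotone hab)⟩
  obtain ⟨N, hN⟩ := (monotone_stabilizes_iff_noetherian.mpr (isNoetherianRing_iff.mp ‹_›)) g
  refine ⟨N, fun m hm => le_antisymm (f.monotone hm) fun r hr => ?_⟩
  have hrm : ι r ∈ g m := Ideal.mem_map_of_mem _ hr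
  rw [← hN m hm] at hrm
  exact mem_of_inclusion_mem_map p S D hDS hkS hyS hy hDp R hR (f N) r hrm

/-! ## The quotient `R ⧸ (y^p) ≃+* S ⧸ (y)` -/

include hDS hkS hyS hy hDp hR in
/-- The map `R → S ⧸ (y)` is SURJECTIVE: `s ≡ r₀ (mod y)` for the constant term `r₀` of the Taylor expansion. [folklore] -/
theorem quotientMap_surjective :
    Function.Surjective ((Ideal.Quotient.mk (Ideal.span {(⟨y, hyS⟩ : S)})).comp (Subring.inclusion (constants_le S D R hR))) := by
  have hp : p.Prime := Fact.out
  intro q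
  obtain ⟨s, rfl⟩ := Ideal.Quotient.mk_surjective q
  obtain ⟨r, hr, hsum⟩ := exists_coeffs p S D hDS hkS hyS hy hDp R hR s.2
  obtain ⟨q', hq'⟩ : ∃ q', p = q' + 1 := ⟨p - 1, (Nat.sub_add_cancel hp.one_le).symm⟩
  -- `s = r 0 + y * w` with `w ∈ S`
  set w : K := ∑ i ∈ Finset.range q', r (i + 1) * (((((i + 1) ! : ℕ) : K))⁻¹ * y ^ i) with hw
  have hwS : w ∈ S := Subring.sum_mem _ fun i _ =>
    S.mul_mem (constants_le S D R hR (hr (i + 1))) (S.mul_mem (inv_natCast_mem S hkS _) (S.pow_mem hyS i))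
  have hs : (s : K) = r 0 + y * w := by
    rw [hsum, hq', Finset.sum_range_succ', hw, Finset.mul_sum]
    simp only [Nat.factorial_zero, Nat.cast_one, inv_one, pow_zero, mul_one]
    rw [add_comm]
    congr 1
    refine Finset.sum_congr rfl fun i _ => ?_
    ring
  refine ⟨⟨r 0, hr 0⟩, ?_⟩
  rw [RingHom.comp_apply, Ideal.Quotient.eq, Ideal.mem_span_singleton']
  refine ⟨-⟨w, hwS⟩, Subtype.ext ?_⟩
  change -w * y = (r 0 : K) - (s : K)
  rw [hs]
  ring

include hDS hkS hyS hy hDp hR in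
/-- The KERNEL of `R → S ⧸ (y)` is `(y ^ p)` (Stage A: `R ∩ y·S = y^p·R`). [folklore] -/
theorem ker_quotientMap :
    RingHom.ker ((Ideal.Quotient.mk (Ideal.span {(⟨y, hyS⟩ : S)})).comp (Subring.inclusion (constants_le S D R hR))) =
      Ideal.span {(⟨y ^ p, pow_char_mem p S D R hR hyS⟩ : R)} := by
  have hp : p.Prime := Fact.out
  apply le_antisymm
  · intro r hr
    rw [RingHom.mem_ker, RingHom.comp_apply, Ideal.Quotient.eq_zero_iff_mem, Ideal.mem_span_singleton'] at hr
    obtain ⟨w, hw⟩ := hr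
    have hw' : y * (w : K) = (r : K) := by
      have := congrArg (fun z : S => (z : K)) hw
      simpa [mul_comm] using this
    obtain ⟨r', hr', hyr⟩ := exists_eq_pow_mul_of_mul_mem p S D hDS hkS hyS hy hDp R hR w.2 (hw' ▸ r.2)
    rw [Ideal.mem_span_singleton']
    refine ⟨⟨r', hr'⟩, Subtype.ext ?_⟩
    change r' * y ^ p = (r : K)
    rw [← hw', hyr, mul_comm]
  · rw [Ideal.span_le, Set.singleton_subset_iff, SetLike.mem_coe, RingHom.mem_ker, RingHom.comp_apply,
      Ideal.Quotient.eq_zero_iff_mem, Ideal.mem_span_singleton']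
    obtain ⟨q', hq'⟩ : ∃ q', p = q' + 1 := ⟨p - 1, (Nat.sub_add_cancel hp.one_le).symm⟩
    refine ⟨⟨y ^ q', S.pow_mem hyS _⟩, Subtype.ext ?_⟩
    change y ^ q' * y = y ^ p
    rw [hq', pow_succ]

/-! ## `y ∉ 𝔪_S²`, regularity of `R`, `y ^ p ∈ 𝔪_R ∖ 𝔪_R²` -/

omit [Fact p.Prime] [CharP K p] in
include hDS hy in
/-- **`y ∉ 𝔪_S²`**: `D` maps `𝔪_S²` into `𝔪_S` (Leibniz), but `D y = 1` is a unit. [folklore] -/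
theorem not_mem_sq_of_apply_eq_one [IsLocalRing S] : (⟨y, hyS⟩ : S) ∉ (maximalIdeal S) ^ 2 := by
  intro h2
  -- `C z := D z ∈ 𝔪_S` holds on `𝔪 * 𝔪`
  have key : ∀ z : S, z ∈ maximalIdeal S * maximalIdeal S → ∃ hz : D (z : K) ∈ S, (⟨D (z : K), hz⟩ : S) ∈ maximalIdeal S := by
    intro z hz
    refine Submodule.mul_induction_on hz ?_ ?_
    · intro m hm n hn
      refine ⟨hDS _ (S.mul_mem m.2 n.2), ?_⟩
      have hmn : (⟨D ((m : K) * (n : K)), hDS _ (S.mul_mem m.2 n.2)⟩ : S) =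
          m * ⟨D (n : K), hDS _ n.2⟩ + n * ⟨D (m : K), hDS _ m.2⟩ := by
        apply Subtype.ext
        change D ((m : K) * (n : K)) = (m : K) * D (n : K) + (n : K) * D (m : K)
        rw [Derivation.leibniz, smul_eq_mul, smul_eq_mul]
      change (⟨D ((m : K) * (n : K)), _⟩ : S) ∈ maximalIdeal S
      rw [hmn]
      exact (maximalIdeal S).add_mem ((maximalIdeal S).mul_mem_right _ hm) ((maximalIdeal S).mul_mem_right _ hn)
    · intro a b ⟨ha, ha'⟩ ⟨hb, hb'⟩
      refine ⟨by rw [Subring.coe_add, map_add]; exact S.add_mem ha hb, ?_⟩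
      have hab : (⟨D ((a + b : S) : K), by rw [Subring.coe_add, map_add]; exact S.add_mem ha hb⟩ : S) =
          ⟨D (a : K), ha⟩ + ⟨D (b : K), hb⟩ := by
        apply Subtype.ext
        change D ((a : K) + (b : K)) = D (a : K) + D (b : K)
        rw [map_add]
      rw [hab]
      exact (maximalIdeal S).add_mem ha' hb'
  rw [pow_two] at h2
  obtain ⟨h1, hmem⟩ := key _ h2
  have hone : (⟨D y, h1⟩ : S) = 1 := Subtype.ext hy
  rw [hone] at hmem
  exact (maximalIdeal.isMaximal S).ne_top ((Ideal.eq_top_iff_one _).mpr hmem)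

include hDS hkS hyS hy hDp hR in
/-- **`R` IS A REGULAR LOCAL RING and `y ^ p ∈ 𝔪_R ∖ 𝔪_R²`** when `S` is regular local and `y ∈ 𝔪_S`: `S ⧸ (y)` is regular
(`y ∉ 𝔪_S²`), hence so is `R ⧸ (y^p) ≅ S ⧸ (y)`, and `y ^ p` is a regular element of the Noetherian local domain `R`
(`IsRegularLocalRing.of_quotient_span_singleton`); were `y ^ p ∈ 𝔪_R²`, `R ⧸ (y^p)` could not be regular. [folklore] -/
theorem isRegularLocalRing_constants [IsRegularLocalRing S] (hym : (⟨y, hyS⟩ : S) ∈ maximalIdeal S) :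
    ∃ _ : IsRegularLocalRing R,
      (⟨y ^ p, pow_char_mem p S D R hR hyS⟩ : R) ∈ maximalIdeal R ∧
        (⟨y ^ p, pow_char_mem p S D R hR hyS⟩ : R) ∉ (maximalIdeal R) ^ 2 := by
  have hp : p.Prime := Fact.out
  haveI : IsLocalRing R := isLocalRing_constants S D R hR
  haveI : IsNoetherianRing R := isNoetherianRing_constants p S D hDS hkS hyS hy hDp R hR
  set yS : S := ⟨y, hyS⟩ with hySdef
  set yp : R := ⟨y ^ p, pow_char_mem p S D R hR hyS⟩ with hypdef
  -- the quotient iso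
  have hsurj := quotientMap_surjective p S D hDS hkS hyS hy hDp R hR
  have hker := ker_quotientMap p S D hDS hkS hyS hy hDp R hR
  let e : (R ⧸ Ideal.span {yp}) ≃+* (S ⧸ Ideal.span {yS}) :=
    (Ideal.quotEquivOfEq hker.symm).trans (RingHom.quotientKerEquivOfSurjective hsurj)
  -- `S ⧸ (y)` regular, hence `R ⧸ (y^p)` regular
  have hy2 : yS ∉ (maximalIdeal S) ^ 2 := not_mem_sq_of_apply_eq_one S D hDS hyS hy
  haveI hSq : IsRegularLocalRing (S ⧸ Ideal.span {yS}) := (IsRegularLocalRing.quotient_span_singleton hym hy2).1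
  haveI hRq : IsRegularLocalRing (R ⧸ Ideal.span {yp}) := IsRegularLocalRing.of_ringEquiv e.symm
  -- `y ^ p ∈ 𝔪_R`: a non-unit (it is one in `S`)
  have hypm : yp ∈ maximalIdeal R := by
    rw [IsLocalRing.mem_maximalIdeal, mem_nonunits_iff, isUnit_constants_iff S D R hR]
    have hySp : Subring.inclusion (constants_le S D R hR) yp = yS ^ p := Subtype.ext rfl
    rw [hySp]
    intro hu
    exact (IsLocalRing.mem_maximalIdeal _).mp hym (isUnit_pow_iff hp.ne_zero |>.mp hu)
  -- `y ^ p` is a regular element of the domain `R`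
  have hy0 : y ≠ 0 := by
    rintro rfl
    rw [map_zero] at hy
    exact zero_ne_one hy
  have hyp0 : yp ≠ 0 := by
    intro h0
    have : y ^ p = 0 := congrArg Subtype.val h0
    exact pow_ne_zero p hy0 this
  have hreg : IsSMulRegular R yp := (IsRegular.of_ne_zero hyp0).left.isSMulRegular
  haveI hRreg : IsRegularLocalRing R := IsRegularLocalRing.of_quotient_span_singleton hypm hreg
  refine ⟨hRreg, hypm, fun h2 => ?_⟩
  exact not_isRegularLocalRing_quotient_span_singleton_of_mem_sq hyp0 h2 hRq

/-! ## The exit -/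

include hDS hkS hyS hy hDp hR in
/-- **DERIVATION CRITERION** (res-L0-w41-strat-1's `exitAt_of_derivation_unit`, KN-free): for a regular local `S ≤ K` containing `k`, a
derivation `D : Derivation k K K` with `D(S) ⊆ S`, `D y = 1` for some `y ∈ 𝔪_S`, and `D^p = 0` on `S`, the constants `R = S ∩ ker D`
carry an EXIT STAGE for every `t ∈ S`: `GenAt R p t y` (`y ^ p ∈ R`, `t ∈ R[y]` by the Taylor expansion) and `OrderOneGen R p y`
(`y ^ p − 0 ^ p` is a one-element part of a regular system of parameters of the regular local ring `R`), i.e. `ExitAt R p t`.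
[folklore] -/
theorem exitAt_of_derivation_unit [IsRegularLocalRing S] (hym : (⟨y, hyS⟩ : S) ∈ maximalIdeal S) {t : K} (ht : t ∈ S) :
    ExitAt R p t := by
  have hp : p.Prime := Fact.out
  haveI : IsLocalRing R := isLocalRing_constants S D R hR
  obtain ⟨hRreg, hypm, hyp2⟩ := isRegularLocalRing_constants p S D hDS hkS hyS hy hDp R hR hym
  -- `t ∈ R[y]` by the Taylor expansion
  have htRy : t ∈ Subring.closure (insert y (R : Set K)) := by
    obtain ⟨r, hr, hsum⟩ := exists_coeffs p S D hDS hkS hyS hy hDp R hR ht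
    rw [hsum]
    refine Subring.sum_mem _ fun i _ => Subring.mul_mem _ (Subring.subset_closure (Or.inr (hr i)))
      (Subring.mul_mem _ (Subring.subset_closure (Or.inr ((hR _).mpr ⟨inv_natCast_mem S hkS _, apply_inv_natCast D _⟩)))
        (Subring.pow_mem _ (Subring.subset_closure (Set.mem_insert y _)) i))
  refine ⟨y, ⟨pow_char_mem p S D R hR hyS, htRy⟩, 0, R.zero_mem, ‹IsLocalRing R›,
    fun _ => ⟨y ^ p, pow_char_mem p S D R hR hyS⟩, LowMult.isRsopPart_one_of_not_mem_sq hypm hyp2, ?_⟩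
  change y ^ p = y ^ p - 0 ^ p
  rw [zero_pow hp.ne_zero, sub_zero]

end Constants

end DerivationExit

end Summit.ResolutionOfSingularities.ResolutionOfSingularities.Theorems.SwitchingDichotomy
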